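import Mathlib
import HarnessLib

/-!
# The abstract BLOW-UP SHELL for small-ball LIMIT laws: exact scaling + domination + pointwise limit ⟹ `μ{F ≤ u}/u^α → v`
# (free-hands support of ⟨stmt-QuantumFields-24197⟩ `SwapVirialDeficit.SwapGluedStiffness`: the generic form of w3 g63's Z5 limit argument
# ✓`ZeroModeSigma.sigmaBall_smallBall_limit`, for the massive-mode rung — the principal σ-sector small-ball LIMIT of the full ring deficit
# `F^S_{000}`, consumed by ✓`SwapRing.tendsto_meanAction_of_principalLimit`)

The cell proves small-ball LIMITS by one pattern (w3 g63 Z5, fcl-p3 g44 K3, w2 g55 Z4-Laplace): an EXACT scaling identity after a blow-up,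
a scale-free integrable DOMINATOR, a POINTWISE limit of the blown-up event off a null set, a good threshold dodging the boundary of the limit
event, dominated convergence along `𝓝[>] 0`, and a rescaling `u ↦ u/r` back to threshold `1`.  This file states that pattern ONCE, for an
abstract finite measure `μ`, a real function `F`, an exponent `α > 0`, an s-finite blow-up space `(B, β)` and abstract blown-up events
`E r u ⊆ B` («`{F ≤ r·u}` seen at scale `u`»):

* (S) scaling      `μ{F ≤ r·u} = ofReal(κ·u^α) · β(E r u)`            (`r, u > 0`);
* (D) domination   for every `r > 0` some `D_r` with `β D_r < ∞` contains `E r u` for all small `u > 0`;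
* (P) pointwise    for `β`-a.e. `x` and every `r > 0` with `G x ≠ r`: eventually (`u → 0⁺`) `x ∈ E r u ↔ (x ∈ Dom₀ ∧ G x < r)`,
                   for a measurable limit functional `G : B → ℝ` and a measurable limit domain `Dom₀`.

CONCLUSIONS: §1 `exists_good_level` (all but countably many thresholds `r` have `β{G = r} = 0`); §2 ★★ `tendsto_measure_blowUp` (at a good
`r`, `β(E r u) → β(Dom₀ ∩ {G < r})`, finite); §3 ★★★ `tendsto_smallBall_div_rpow_of_good` (`μ{F ≤ u}/u^α → κ·r^{−α}·β(Dom₀ ∩ {G < r})` for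
every good `r > 0`) and ★★★ `smallBall_limit_of_blowUp` (`∃ v ≥ 0, μ{F ≤ u}/u^α → v`); §4 `smallBall_limit_pos_of_floor` (`v > 0` given a floor
`c·u^α ≤ μ{F ≤ u}`).

For the σ-glued ring at fixed `L` the intended instance is: `μ = ringMeasure L`, `F = swapRingDeficit L 0`, `α = 9L⁴ − 1`, `B` = (hub, cone
measure) × (three leaders, Lebesgue on `ℍ³`) × (`6L⁴ − 3` followers, Lebesgue on `ℍ^{6L⁴−3}`), the blow-up = w3 g63's `arrange ∘ straighten ∘
translate ∘ dil3 √u` on the leaders × `dilateIm √u` about its slaved value on every follower (Jacobian EXACTLY `u^{9L⁴−1}`), (D) from the box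
✓`SwapRing.swapCommBox_of_swapRingDeficit` × ✓`ZeroModeSigma` dominator at scale `60L³√u`, (P) from the one-variable Taylor limit
`F(Φ_t x)/t² → ½(d/dt)²F(Φ_t x)|₀` (F is a polynomial in the letters), `G` = that second derivative.  None of that instance is built here.
HONEST LABEL: pure measure theory (plan-level plumbing); NOT the fixed-`L` sharp law, NOT ⟨24197⟩; the Yang–Mills mass gap is NOT proved; no
summit is proved by a line.  Seat ym-line-fcl-p3 g45 (cell ym-idea-1, free hands; item of record ⟨24085⟩ aside, untouched),
`--supports stmt-QuantumFields-24197`.  THEOREMS ONLY (0 `def`, 0 `sorry`), standard axioms.  References: [folklore] (dominated convergence;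
Bingham–Goldie–Teugels §1.7 for the regular-variation reading).
-/

set_option autoImplicit false

noncomputable section

open MeasureTheory Set Filter Topology
open scoped ENNReal

namespace Summit.QuantumFields.YangMills.Theorems.SwapVirialDeficit.BlowUp

variable {Ω B : Type*} [MeasurableSpace Ω] [MeasurableSpace B]

/-! ## §1 Good thresholds -/

/-- **Good levels are co-countable**: for an s-finite measure `β` and a measurable real functional `G`, every non-trivial interval `(a, b)`
contains a level `r` whose level set `{G = r}` is `β`-null (`Measure.countable_meas_level_set_pos`). [folklore] -/
theorem exists_good_level (β : Measure B) [SFinite β] {G : B → ℝ} (hG : Measurable G) {a b : ℝ} (hab : a < b) :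
    ∃ r : ℝ, r ∈ Ioo a b ∧ β {x | G x = r} = 0 := by
  set C : Set ℝ := {t : ℝ | 0 < β {x | G x = t}} with hC
  have hCc : C.Countable := Measure.countable_meas_level_set_pos hG
  have hC0 : (volume : Measure ℝ) C = 0 := hCc.measure_zero _
  have hns : ¬ (Ioo a b ⊆ C) := by
    intro h
    have h1 : (volume : Measure ℝ) (Ioo a b) ≤ 0 := (measure_mono h).trans hC0.le
    rw [Real.volume_Ioo] at h1
    have h2 : ENNReal.ofReal (b - a) = 0 := le_antisymm h1 bot_le
    rw [ENNReal.ofReal_eq_zero] at h2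
    linarith
  obtain ⟨r, hr, hrC⟩ := not_subset.1 hns
  refine ⟨r, hr, ?_⟩
  by_contra hne0
  exact hrC (pos_iff_ne_zero.2 hne0)

/-! ## §2 Dominated convergence of the blown-up events along the scale -/

/-- ★★ **The blown-up events converge in measure-of-set**: if the measurable events `E u ⊆ B` sit inside a fixed set `D` of finite `β`-measure for
all small `u > 0`, and `β`-a.e. point is EVENTUALLY (as `u → 0⁺`) in `E u` exactly when it is in the measurable limit set `T`, then `β(E u) → β T`
and `β T < ∞` (dominated convergence for indicators along the countably generated filter `𝓝[>] 0`). [folklore] -/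
theorem tendsto_measure_blowUp (β : Measure B) {E : ℝ → Set B} (hE : ∀ u, MeasurableSet (E u)) {D : Set B} (hD : β D ≠ ∞)
    (hsub : ∀ᶠ u in 𝓝[>] (0 : ℝ), E u ⊆ D) {T : Set B} (hT : MeasurableSet T)
    (hpt : ∀ᵐ x ∂β, ∀ᶠ u in 𝓝[>] (0 : ℝ), (x ∈ E u ↔ x ∈ T)) :
    Tendsto (fun u : ℝ => β (E u)) (𝓝[>] (0 : ℝ)) (𝓝 (β T)) ∧ β T ≠ ∞ := by
  -- indicators
  have hI : ∀ u, β (E u) = ∫⁻ x, (E u).indicator (1 : B → ℝ≥0∞) x ∂β := fun u => (lintegral_indicator_one (hE u)).symm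
  have hIT : β T = ∫⁻ x, T.indicator (1 : B → ℝ≥0∞) x ∂β := (lintegral_indicator_one hT).symm
  have hID : ∫⁻ x, D.indicator (1 : B → ℝ≥0∞) x ∂β ≤ β D := by
    calc ∫⁻ x, D.indicator (1 : B → ℝ≥0∞) x ∂β ≤ ∫⁻ x, (toMeasurable β D).indicator (1 : B → ℝ≥0∞) x ∂β :=
          lintegral_mono fun x => indicator_le_indicator_of_subset (subset_toMeasurable β D) (fun _ => zero_le) x
      _ = β (toMeasurable β D) := lintegral_indicator_one (measurableSet_toMeasurable β D)
      _ = β D := measure_toMeasurable D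
  have hT' : Tendsto (fun u : ℝ => ∫⁻ x, (E u).indicator (1 : B → ℝ≥0∞) x ∂β) (𝓝[>] (0 : ℝ))
      (𝓝 (∫⁻ x, T.indicator (1 : B → ℝ≥0∞) x ∂β)) := by
    refine tendsto_lintegral_filter_of_dominated_convergence (D.indicator (1 : B → ℝ≥0∞)) ?_ ?_ ?_ ?_
    · exact Eventually.of_forall fun u => measurable_one.indicator (hE u)
    · filter_upwards [hsub] with u hu
      exact Eventually.of_forall fun x => indicator_le_indicator_of_subset hu (fun _ => zero_le) x
    · exact ne_top_of_le_ne_top hD hID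
    · filter_upwards [hpt] with x hx
      refine (tendsto_congr' ?_).2 tendsto_const_nhds
      filter_upwards [hx] with u hu
      by_cases hm : x ∈ T
      · rw [indicator_of_mem (hu.2 hm), indicator_of_mem hm]
      · rw [indicator_of_notMem hm, indicator_of_notMem (fun h => hm (hu.1 h))]
  have hmain : Tendsto (fun u : ℝ => β (E u)) (𝓝[>] (0 : ℝ)) (𝓝 (β T)) := by
    rw [hIT]
    simpa only [hI] using hT'
  refine ⟨hmain, ?_⟩
  -- finiteness of the limit: `β T ≤ β D`
  have hle : β T ≤ β D := by
    refine le_of_tendsto hmain ?_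
    filter_upwards [hsub] with u hu using measure_mono hu
  exact ne_top_of_le_ne_top hD hle

/-! ## §3 The shell -/

/-- ★★★ **SMALL-BALL LIMIT FROM A BLOW-UP, at a good threshold.**  Let `μ` be a measure, `F` a real function, `α` real, `κ ≥ 0`; let
`(B, β)` be a blow-up space with blown-up events `E r u` satisfying the SCALING identity `μ{F ≤ r·u} = ofReal(κ·u^α)·β(E r u)` (`r, u > 0`),
the DOMINATION (for every `r > 0` a set of finite measure containing `E r u` for all small `u`), and the POINTWISE limit (a.e., for every
`r > 0` off the level `G x = r`, eventually `x ∈ E r u ↔ x ∈ Dom₀ ∧ G x < r`).  Then for every threshold `r > 0` whose level set is null,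
`μ{F ≤ u}/u^α → κ·r^{−α}·β(Dom₀ ∩ {G < r})` as `u → 0⁺`, and that measure is finite. [folklore] -/
theorem tendsto_smallBall_div_rpow_of_good (μ : Measure Ω) {F : Ω → ℝ} {α κ : ℝ} (hκ : 0 ≤ κ)
    (β : Measure B) {E : ℝ → ℝ → Set B} (hEm : ∀ r u, MeasurableSet (E r u))
    (hS : ∀ r u : ℝ, 0 < r → 0 < u → μ {ω | F ω ≤ r * u} = ENNReal.ofReal (κ * u ^ α) * β (E r u))
    (hD : ∀ r : ℝ, 0 < r → ∃ D : Set B, β D ≠ ∞ ∧ ∀ᶠ u in 𝓝[>] (0 : ℝ), E r u ⊆ D)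
    {G : B → ℝ} (hG : Measurable G) {Dom₀ : Set B} (hDom : MeasurableSet Dom₀)
    (hP : ∀ᵐ x ∂β, ∀ r : ℝ, 0 < r → G x ≠ r → ∀ᶠ u in 𝓝[>] (0 : ℝ), (x ∈ E r u ↔ (x ∈ Dom₀ ∧ G x < r)))
    {r : ℝ} (hr : 0 < r) (hgood : β {x | G x = r} = 0) :
    Tendsto (fun u : ℝ => (μ {ω | F ω ≤ u}).toReal / u ^ α) (𝓝[>] (0 : ℝ))
        (𝓝 (κ * r ^ (-α) * (β (Dom₀ ∩ {x | G x < r})).toReal)) ∧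
      β (Dom₀ ∩ {x | G x < r}) ≠ ∞ := by
  set T : Set B := Dom₀ ∩ {x | G x < r} with hTdef
  have hT : MeasurableSet T := hDom.inter (measurableSet_lt hG measurable_const)
  obtain ⟨D, hDfin, hsub⟩ := hD r hr
  -- a.e. eventual membership
  have hpt : ∀ᵐ x ∂β, ∀ᶠ u in 𝓝[>] (0 : ℝ), (x ∈ E r u ↔ x ∈ T) := by
    have hne : ∀ᵐ x ∂β, G x ≠ r := by
      rw [ae_iff]
      simpa only [ne_eq, not_not] using hgood
    filter_upwards [hP, hne] with x hx hxr
    exact hx r hr hxr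
  obtain ⟨hconv, hTfin⟩ := tendsto_measure_blowUp β (fun u => hEm r u) hDfin hsub hT hpt
  refine ⟨?_, hTfin⟩
  -- the scale `u ↦ u / r → 0⁺`
  have hscale : Tendsto (fun u : ℝ => u / r) (𝓝[>] (0 : ℝ)) (𝓝[>] (0 : ℝ)) := by
    refine tendsto_nhdsWithin_iff.2 ⟨?_, ?_⟩
    · have h : Tendsto (fun u : ℝ => u / r) (𝓝 (0 : ℝ)) (𝓝 (0 / r)) := (continuous_id.div_const r).tendsto 0
      rw [zero_div] at h
      exact h.mono_left nhdsWithin_le_nhds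
    · filter_upwards [self_mem_nhdsWithin] with u hu using div_pos hu hr
  have hreal : Tendsto (fun u : ℝ => (β (E r (u / r))).toReal) (𝓝[>] (0 : ℝ)) (𝓝 (β T).toReal) :=
    ((ENNReal.tendsto_toReal hTfin).comp hconv).comp hscale
  have hlim := hreal.const_mul (κ * r ^ (-α))
  refine (tendsto_congr' ?_).2 hlim
  filter_upwards [self_mem_nhdsWithin] with u hu
  have hu0 : (0 : ℝ) < u := hu
  have hur : 0 < u / r := div_pos hu0 hr
  -- `μ{F ≤ u} = μ{F ≤ r·(u/r)} = ofReal(κ (u/r)^α) β(E r (u/r))`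
  have hset : {ω | F ω ≤ u} = {ω | F ω ≤ r * (u / r)} := by
    rw [mul_div_cancel₀ u hr.ne']
  rw [hset, hS r (u / r) hr hur, ENNReal.toReal_mul, ENNReal.toReal_ofReal (by positivity)]
  have hpow : (u / r) ^ α = u ^ α * r ^ (-α) := by
    rw [Real.div_rpow hu0.le hr.le, Real.rpow_neg hr.le, div_eq_mul_inv]
  have huα : u ^ α ≠ 0 := (Real.rpow_pos_of_pos hu0 α).ne'
  rw [hpow]
  field_simp

/-- ★★★ **SMALL-BALL LIMIT FROM A BLOW-UP.**  Under the scaling identity (S), the domination (D) and the pointwise limit (P) of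
`tendsto_smallBall_div_rpow_of_good`, on an s-finite blow-up space: `∃ v ≥ 0, μ{F ≤ u}/u^α → v` as `u → 0⁺` (a good threshold exists by
`exists_good_level`).  This is the shape consumed by ✓`SwapRing.tendsto_meanAction_of_principalLimit` (with `μ.real`). [folklore] -/
theorem smallBall_limit_of_blowUp (μ : Measure Ω) {F : Ω → ℝ} {α κ : ℝ} (hκ : 0 ≤ κ)
    (β : Measure B) [SFinite β] {E : ℝ → ℝ → Set B} (hEm : ∀ r u, MeasurableSet (E r u))
    (hS : ∀ r u : ℝ, 0 < r → 0 < u → μ {ω | F ω ≤ r * u} = ENNReal.ofReal (κ * u ^ α) * β (E r u))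
    (hD : ∀ r : ℝ, 0 < r → ∃ D : Set B, β D ≠ ∞ ∧ ∀ᶠ u in 𝓝[>] (0 : ℝ), E r u ⊆ D)
    {G : B → ℝ} (hG : Measurable G) {Dom₀ : Set B} (hDom : MeasurableSet Dom₀)
    (hP : ∀ᵐ x ∂β, ∀ r : ℝ, 0 < r → G x ≠ r → ∀ᶠ u in 𝓝[>] (0 : ℝ), (x ∈ E r u ↔ (x ∈ Dom₀ ∧ G x < r))) :
    ∃ v : ℝ, 0 ≤ v ∧ Tendsto (fun u : ℝ => (μ {ω | F ω ≤ u}).toReal / u ^ α) (𝓝[>] (0 : ℝ)) (𝓝 v) := by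
  obtain ⟨r, hr, hgood⟩ := exists_good_level β hG (show (1 : ℝ) < 2 by norm_num)
  have hr0 : 0 < r := lt_trans one_pos hr.1
  obtain ⟨hT, -⟩ := tendsto_smallBall_div_rpow_of_good μ hκ β hEm hS hD hG hDom hP hr0 hgood
  exact ⟨_, by positivity, hT⟩

/-! ## §4 Positivity of the limit from a floor -/

/-- **The limit is positive given a floor**: if `μ{F ≤ u}/u^α → v` and `c·u^α ≤ μ{F ≤ u}` for all small `u > 0` with `c > 0`, then `0 < v`
(for the σ-glued ring the floor is ✓`SwapRing.swap_volume_floor`). [folklore] -/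
theorem smallBall_limit_pos_of_floor (μ : Measure Ω) {F : Ω → ℝ} {α v c u₀ : ℝ} (hc : 0 < c) (hu₀ : 0 < u₀)
    (hfloor : ∀ u : ℝ, 0 < u → u ≤ u₀ → c * u ^ α ≤ (μ {ω | F ω ≤ u}).toReal)
    (hlim : Tendsto (fun u : ℝ => (μ {ω | F ω ≤ u}).toReal / u ^ α) (𝓝[>] (0 : ℝ)) (𝓝 v)) :
    0 < v := by
  have hge : ∀ᶠ u in 𝓝[>] (0 : ℝ), c ≤ (μ {ω | F ω ≤ u}).toReal / u ^ α := by
    filter_upwards [Ioc_mem_nhdsGT hu₀] with u hu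
    have hα : 0 < u ^ α := Real.rpow_pos_of_pos hu.1 α
    rw [le_div_iff₀ hα]
    exact hfloor u hu.1 hu.2
  exact lt_of_lt_of_le hc (ge_of_tendsto hlim hge)

/-- **The `μ.real` form** of `smallBall_limit_of_blowUp` with positivity: under (S), (D), (P) on an s-finite blow-up space and a floor
`c·u^α ≤ μ.real{F ≤ u}` on `(0, u₀]`, there is `v > 0` with `μ.real{F ≤ u}/u^α → v` — literally the hypothesis `hlim` of
✓`SwapRing.tendsto_meanAction_of_principalLimit` once `α` is instantiated to `9L⁴ − 1` (ℕ-power, see `rpow_natCast`). [folklore] -/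
theorem smallBall_limit_real_of_blowUp (μ : Measure Ω) {F : Ω → ℝ} {α κ : ℝ} (hκ : 0 ≤ κ)
    (β : Measure B) [SFinite β] {E : ℝ → ℝ → Set B} (hEm : ∀ r u, MeasurableSet (E r u))
    (hS : ∀ r u : ℝ, 0 < r → 0 < u → μ {ω | F ω ≤ r * u} = ENNReal.ofReal (κ * u ^ α) * β (E r u))
    (hD : ∀ r : ℝ, 0 < r → ∃ D : Set B, β D ≠ ∞ ∧ ∀ᶠ u in 𝓝[>] (0 : ℝ), E r u ⊆ D)
    {G : B → ℝ} (hG : Measurable G) {Dom₀ : Set B} (hDom : MeasurableSet Dom₀)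
    (hP : ∀ᵐ x ∂β, ∀ r : ℝ, 0 < r → G x ≠ r → ∀ᶠ u in 𝓝[>] (0 : ℝ), (x ∈ E r u ↔ (x ∈ Dom₀ ∧ G x < r)))
    {c u₀ : ℝ} (hc : 0 < c) (hu₀ : 0 < u₀) (hfloor : ∀ u : ℝ, 0 < u → u ≤ u₀ → c * u ^ α ≤ μ.real {ω | F ω ≤ u}) :
    ∃ v : ℝ, 0 < v ∧ Tendsto (fun u : ℝ => μ.real {ω | F ω ≤ u} / u ^ α) (𝓝[>] (0 : ℝ)) (𝓝 v) := by
  obtain ⟨v, -, hv⟩ := smallBall_limit_of_blowUp μ hκ β hEm hS hD hG hDom hP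
  have hv' : Tendsto (fun u : ℝ => μ.real {ω | F ω ≤ u} / u ^ α) (𝓝[>] (0 : ℝ)) (𝓝 v) := by
    simpa only [measureReal_def] using hv
  refine ⟨v, smallBall_limit_pos_of_floor μ hc hu₀ (fun u hu hu' => ?_) hv, hv'⟩
  rw [← measureReal_def]; exact hfloor u hu hu'


/-! ## §5 Domination by an integrable WEIGHT (appended): the form the σ-glued ring needs
(w3 g63's leader dominator ✓`ZeroModeSigma.sigmaDom` is a Gaussian-type weight on an unbounded region, not the indicator of a set of finite measure) -/

/-- ★★ **The blown-up events converge, weight-dominated form**: as `tendsto_measure_blowUp`, with the domination `𝟙_{E u} ≤ Φ` for all small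
`u > 0` by a weight `Φ` of finite integral instead of a set of finite measure. [folklore] -/
theorem tendsto_measure_blowUp_of_weight (β : Measure B) {E : ℝ → Set B} (hE : ∀ u, MeasurableSet (E u)) {Φ : B → ℝ≥0∞}
    (hΦ : ∫⁻ x, Φ x ∂β ≠ ∞) (hsub : ∀ᶠ u in 𝓝[>] (0 : ℝ), ∀ x ∈ E u, 1 ≤ Φ x) {T : Set B} (hT : MeasurableSet T)
    (hpt : ∀ᵐ x ∂β, ∀ᶠ u in 𝓝[>] (0 : ℝ), (x ∈ E u ↔ x ∈ T)) :
    Tendsto (fun u : ℝ => β (E u)) (𝓝[>] (0 : ℝ)) (𝓝 (β T)) ∧ β T ≠ ∞ := by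
  have hI : ∀ u, β (E u) = ∫⁻ x, (E u).indicator (1 : B → ℝ≥0∞) x ∂β := fun u => (lintegral_indicator_one (hE u)).symm
  have hIT : β T = ∫⁻ x, T.indicator (1 : B → ℝ≥0∞) x ∂β := (lintegral_indicator_one hT).symm
  have hdom : ∀ᶠ u in 𝓝[>] (0 : ℝ), ∀ᵐ x ∂β, (E u).indicator (1 : B → ℝ≥0∞) x ≤ Φ x := by
    filter_upwards [hsub] with u hu
    refine Eventually.of_forall fun x => ?_
    by_cases hx : x ∈ E u
    · rw [indicator_of_mem hx, Pi.one_apply]; exact hu x hx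
    · rw [indicator_of_notMem hx]; exact bot_le
  have hT' : Tendsto (fun u : ℝ => ∫⁻ x, (E u).indicator (1 : B → ℝ≥0∞) x ∂β) (𝓝[>] (0 : ℝ))
      (𝓝 (∫⁻ x, T.indicator (1 : B → ℝ≥0∞) x ∂β)) := by
    refine tendsto_lintegral_filter_of_dominated_convergence Φ ?_ hdom hΦ ?_
    · exact Eventually.of_forall fun u => measurable_one.indicator (hE u)
    · filter_upwards [hpt] with x hx
      refine (tendsto_congr' ?_).2 tendsto_const_nhds
      filter_upwards [hx] with u hu
      by_cases hm : x ∈ T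
      · rw [indicator_of_mem (hu.2 hm), indicator_of_mem hm]
      · rw [indicator_of_notMem hm, indicator_of_notMem (fun h => hm (hu.1 h))]
  have hmain : Tendsto (fun u : ℝ => β (E u)) (𝓝[>] (0 : ℝ)) (𝓝 (β T)) := by
    rw [hIT]
    simpa only [hI] using hT'
  refine ⟨hmain, ?_⟩
  -- finiteness: `β(E u) ≤ ∫Φ` for small `u`, hence `β T ≤ ∫Φ`
  have hle : β T ≤ ∫⁻ x, Φ x ∂β := by
    refine le_of_tendsto hmain ?_
    filter_upwards [hdom] with u hu
    rw [hI u]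
    exact lintegral_mono_ae hu
  exact ne_top_of_le_ne_top hΦ hle

/-- ★★★ **SMALL-BALL LIMIT FROM A BLOW-UP, weight-dominated form, at a good threshold**: as `tendsto_smallBall_div_rpow_of_good` with (D)
replaced by (D′): for every `r > 0` a weight `Φ_r` of finite `β`-integral with `𝟙_{E r u} ≤ Φ_r` for all small `u > 0`. [folklore] -/
theorem tendsto_smallBall_div_rpow_of_good_of_weight (μ : Measure Ω) {F : Ω → ℝ} {α κ : ℝ} (hκ : 0 ≤ κ)
    (β : Measure B) {E : ℝ → ℝ → Set B} (hEm : ∀ r u, MeasurableSet (E r u))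
    (hS : ∀ r u : ℝ, 0 < r → 0 < u → μ {ω | F ω ≤ r * u} = ENNReal.ofReal (κ * u ^ α) * β (E r u))
    (hD : ∀ r : ℝ, 0 < r → ∃ Φ : B → ℝ≥0∞, ∫⁻ x, Φ x ∂β ≠ ∞ ∧ ∀ᶠ u in 𝓝[>] (0 : ℝ), ∀ x ∈ E r u, 1 ≤ Φ x)
    {G : B → ℝ} (hG : Measurable G) {Dom₀ : Set B} (hDom : MeasurableSet Dom₀)
    (hP : ∀ᵐ x ∂β, ∀ r : ℝ, 0 < r → G x ≠ r → ∀ᶠ u in 𝓝[>] (0 : ℝ), (x ∈ E r u ↔ (x ∈ Dom₀ ∧ G x < r)))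
    {r : ℝ} (hr : 0 < r) (hgood : β {x | G x = r} = 0) :
    Tendsto (fun u : ℝ => (μ {ω | F ω ≤ u}).toReal / u ^ α) (𝓝[>] (0 : ℝ))
        (𝓝 (κ * r ^ (-α) * (β (Dom₀ ∩ {x | G x < r})).toReal)) ∧
      β (Dom₀ ∩ {x | G x < r}) ≠ ∞ := by
  set T : Set B := Dom₀ ∩ {x | G x < r} with hTdef
  have hT : MeasurableSet T := hDom.inter (measurableSet_lt hG measurable_const)
  obtain ⟨Φ, hΦfin, hsub⟩ := hD r hr
  have hpt : ∀ᵐ x ∂β, ∀ᶠ u in 𝓝[>] (0 : ℝ), (x ∈ E r u ↔ x ∈ T) := by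
    have hne : ∀ᵐ x ∂β, G x ≠ r := by
      rw [ae_iff]
      simpa only [ne_eq, not_not] using hgood
    filter_upwards [hP, hne] with x hx hxr
    exact hx r hr hxr
  obtain ⟨hconv, hTfin⟩ := tendsto_measure_blowUp_of_weight β (fun u => hEm r u) hΦfin hsub hT hpt
  refine ⟨?_, hTfin⟩
  have hscale : Tendsto (fun u : ℝ => u / r) (𝓝[>] (0 : ℝ)) (𝓝[>] (0 : ℝ)) := by
    refine tendsto_nhdsWithin_iff.2 ⟨?_, ?_⟩
    · have h : Tendsto (fun u : ℝ => u / r) (𝓝 (0 : ℝ)) (𝓝 (0 / r)) := (continuous_id.div_const r).tendsto 0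
      rw [zero_div] at h
      exact h.mono_left nhdsWithin_le_nhds
    · filter_upwards [self_mem_nhdsWithin] with u hu using div_pos hu hr
  have hreal : Tendsto (fun u : ℝ => (β (E r (u / r))).toReal) (𝓝[>] (0 : ℝ)) (𝓝 (β T).toReal) :=
    ((ENNReal.tendsto_toReal hTfin).comp hconv).comp hscale
  have hlim := hreal.const_mul (κ * r ^ (-α))
  refine (tendsto_congr' ?_).2 hlim
  filter_upwards [self_mem_nhdsWithin] with u hu
  have hu0 : (0 : ℝ) < u := hu
  have hur : 0 < u / r := div_pos hu0 hr
  have hset : {ω | F ω ≤ u} = {ω | F ω ≤ r * (u / r)} := by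
    rw [mul_div_cancel₀ u hr.ne']
  rw [hset, hS r (u / r) hr hur, ENNReal.toReal_mul, ENNReal.toReal_ofReal (by positivity)]
  have hpow : (u / r) ^ α = u ^ α * r ^ (-α) := by
    rw [Real.div_rpow hu0.le hr.le, Real.rpow_neg hr.le, div_eq_mul_inv]
  have huα : u ^ α ≠ 0 := (Real.rpow_pos_of_pos hu0 α).ne'
  rw [hpow]
  field_simp

/-- ★★★ **SMALL-BALL LIMIT FROM A BLOW-UP, weight-dominated, `μ.real` form with positivity**: under the scaling (S), the weight domination (D′),
the pointwise limit (P) on an s-finite blow-up space, and a floor `c·u^α ≤ μ.real{F ≤ u}` on `(0, u₀]`: `∃ v > 0, μ.real{F ≤ u}/u^α → v` —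
literally the hypothesis of ✓`SwapRing.tendsto_meanAction_of_principalLimit` (the σ-glued ring: leaders dominated by w3 g63's
✓`ZeroModeSigma.sigmaDom` dilated by `dil3 (60L³√r)`, followers by a box). [folklore] -/
theorem smallBall_limit_real_of_blowUp_of_weight (μ : Measure Ω) {F : Ω → ℝ} {α κ : ℝ} (hκ : 0 ≤ κ)
    (β : Measure B) [SFinite β] {E : ℝ → ℝ → Set B} (hEm : ∀ r u, MeasurableSet (E r u))
    (hS : ∀ r u : ℝ, 0 < r → 0 < u → μ {ω | F ω ≤ r * u} = ENNReal.ofReal (κ * u ^ α) * β (E r u))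
    (hD : ∀ r : ℝ, 0 < r → ∃ Φ : B → ℝ≥0∞, ∫⁻ x, Φ x ∂β ≠ ∞ ∧ ∀ᶠ u in 𝓝[>] (0 : ℝ), ∀ x ∈ E r u, 1 ≤ Φ x)
    {G : B → ℝ} (hG : Measurable G) {Dom₀ : Set B} (hDom : MeasurableSet Dom₀)
    (hP : ∀ᵐ x ∂β, ∀ r : ℝ, 0 < r → G x ≠ r → ∀ᶠ u in 𝓝[>] (0 : ℝ), (x ∈ E r u ↔ (x ∈ Dom₀ ∧ G x < r)))
    {c u₀ : ℝ} (hc : 0 < c) (hu₀ : 0 < u₀) (hfloor : ∀ u : ℝ, 0 < u → u ≤ u₀ → c * u ^ α ≤ μ.real {ω | F ω ≤ u}) :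
    ∃ v : ℝ, 0 < v ∧ Tendsto (fun u : ℝ => μ.real {ω | F ω ≤ u} / u ^ α) (𝓝[>] (0 : ℝ)) (𝓝 v) := by
  obtain ⟨r, hr, hgood⟩ := exists_good_level β hG (show (1 : ℝ) < 2 by norm_num)
  have hr0 : 0 < r := lt_trans one_pos hr.1
  obtain ⟨hT, -⟩ := tendsto_smallBall_div_rpow_of_good_of_weight μ hκ β hEm hS hD hG hDom hP hr0 hgood
  have hv' : Tendsto (fun u : ℝ => μ.real {ω | F ω ≤ u} / u ^ α) (𝓝[>] (0 : ℝ))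
      (𝓝 (κ * r ^ (-α) * (β (Dom₀ ∩ {x | G x < r})).toReal)) := by
    simpa only [measureReal_def] using hT
  refine ⟨_, smallBall_limit_pos_of_floor μ hc hu₀ (fun u hu hu' => ?_) hT, hv'⟩
  rw [← measureReal_def]; exact hfloor u hu hu'

end Summit.QuantumFields.YangMills.Theorems.SwapVirialDeficit.BlowUp

end
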